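import Summits.CriticalPhenomena.CardyFormulaZ2.Theorems.CardyComplexConeParafermionToSLESixFamiliesDefs
import Literature.Probability.LatticeModels.MedialInterfaceProofs
import HarnessLib

/-!
# Envelope of the conditional parafermionic amplitude (glue for line `caratheodory-net-slit-uniformity`)

Crux `ParafermionToSLESixFamilies` (stmt-CriticalPhenomena-11389), registered glue sub-goals
`norm_condObs_le` and `norm_obs_le` of the checked skeleton
`Cruxes/ParafermionToSLESixFamilies/Lines/caratheodory_net_slit_uniformity.lean`.

A medial exploration path of bond percolation on `δℤ²` visits every medial vertex at most
twice (`card_passages_le_two`): three passages through `z` would need three distinct medial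
darts into `z` or three out of `z` (no medial edge is repeated, `IsMedialExploration.nodup`),
but only two medial darts enter and two leave a medial vertex (one per endpoint of the edge);
the remaining configuration (first and last passage at `z`) is excluded by `e_a ≠ e_b`. Hence
the twisted passage sum of Smirnov's observable has norm at most `2` pathwise, and so do the
observable `obs` and its square-resampled conditional form `condObs`, for every datum, square and
outer configuration — the trivial envelope that the conjecture-strength a-priori bound
`KoebeShadowSquares` (K1) sharpens to `C·n^{-1/3}`.
-/

noncomputable section

open scoped Topology NNReal ENNReal
open Filter Set MeasureTheory
open Literature.Probability Literature.Probability.LatticeModels Literature.Probability.Percolation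

namespace Summit.CriticalPhenomena.CardyFormulaZ2.Cruxes.ParafermionToSLESixFamilies.CaratheodoryNetSlitUniformity


/-! ### At most two medial darts enter, and at most two leave, a medial vertex -/

/-- Among three medial darts INTO the same medial vertex two coincide: a dart into `z` is the
corner `(v, f)` with target `z`, determined by its left vertex `v ∈ z` (two choices). -/
theorem eq_or_eq_of_isMedialDart_target {e₁ e₂ e₃ z : MedialVertex}
    (h₁ : IsMedialDart e₁ z) (h₂ : IsMedialDart e₂ z) (h₃ : IsMedialDart e₃ z) :
    e₁ = e₂ ∨ e₁ = e₃ ∨ e₂ = e₃ := by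
  obtain ⟨v₁, f₁, hc₁, rfl, hz₁⟩ := h₁
  obtain ⟨v₂, f₂, hc₂, rfl, hz₂⟩ := h₂
  obtain ⟨v₃, f₃, hc₃, rfl, hz₃⟩ := h₃
  obtain ⟨k₁, rfl⟩ := exists_faceAt_of_isCorner hc₁
  obtain ⟨k₂, rfl⟩ := exists_faceAt_of_isCorner hc₂
  obtain ⟨k₃, rfl⟩ := exists_faceAt_of_isCorner hc₃
  rw [cornerTarget_faceAt] at hz₁ hz₂ hz₃
  simp only [cornerSource_faceAt]
  have H : ∀ {v w : Site 2} {k j : Fin 4}, s(v, v + cornerUnit (k + 1)) = z →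
      s(w, w + cornerUnit (j + 1)) = z → v = w →
      s(v, v + cornerUnit k) = s(w, w + cornerUnit j) := by
    rintro v w k j hv hw rfl
    have h := cornerUnit_injective (eq_of_sym2_add_eq (hv.trans hw.symm))
    rw [add_right_cancel h]
  have hm₁ : v₁ ∈ z := hz₁ ▸ Sym2.mem_mk_left _ _
  have hm₂ : v₂ ∈ z := hz₂ ▸ Sym2.mem_mk_left _ _
  have hm₃ : v₃ ∈ z := hz₃ ▸ Sym2.mem_mk_left _ _
  induction z using Sym2.ind with
  | h x y =>
    rcases Sym2.mem_iff.1 hm₁ with h₁ | h₁ <;> rcases Sym2.mem_iff.1 hm₂ with h₂ | h₂ <;>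
      rcases Sym2.mem_iff.1 hm₃ with h₃ | h₃
    · exact Or.inl (H hz₁ hz₂ (h₁.trans h₂.symm))
    · exact Or.inl (H hz₁ hz₂ (h₁.trans h₂.symm))
    · exact Or.inr (Or.inl (H hz₁ hz₃ (h₁.trans h₃.symm)))
    · exact Or.inr (Or.inr (H hz₂ hz₃ (h₂.trans h₃.symm)))
    · exact Or.inr (Or.inr (H hz₂ hz₃ (h₂.trans h₃.symm)))
    · exact Or.inr (Or.inl (H hz₁ hz₃ (h₁.trans h₃.symm)))
    · exact Or.inl (H hz₁ hz₂ (h₁.trans h₂.symm))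
    · exact Or.inl (H hz₁ hz₂ (h₁.trans h₂.symm))

/-- Among three medial darts OUT OF the same medial vertex two coincide: a dart out of `z` is the
corner `(v, f)` with source `z`, determined by its left vertex `v ∈ z` (two choices). -/
theorem eq_or_eq_of_isMedialDart_source {e₁ e₂ e₃ z : MedialVertex}
    (h₁ : IsMedialDart z e₁) (h₂ : IsMedialDart z e₂) (h₃ : IsMedialDart z e₃) :
    e₁ = e₂ ∨ e₁ = e₃ ∨ e₂ = e₃ := by
  obtain ⟨v₁, f₁, hc₁, hz₁, rfl⟩ := h₁
  obtain ⟨v₂, f₂, hc₂, hz₂, rfl⟩ := h₂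
  obtain ⟨v₃, f₃, hc₃, hz₃, rfl⟩ := h₃
  obtain ⟨k₁, rfl⟩ := exists_faceAt_of_isCorner hc₁
  obtain ⟨k₂, rfl⟩ := exists_faceAt_of_isCorner hc₂
  obtain ⟨k₃, rfl⟩ := exists_faceAt_of_isCorner hc₃
  rw [cornerSource_faceAt] at hz₁ hz₂ hz₃
  simp only [cornerTarget_faceAt]
  have H : ∀ {v w : Site 2} {k j : Fin 4}, s(v, v + cornerUnit k) = z →
      s(w, w + cornerUnit j) = z → v = w →
      s(v, v + cornerUnit (k + 1)) = s(w, w + cornerUnit (j + 1)) := by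
    rintro v w k j hv hw rfl
    rw [cornerUnit_injective (eq_of_sym2_add_eq (hv.trans hw.symm))]
  have hm₁ : v₁ ∈ z := hz₁ ▸ Sym2.mem_mk_left _ _
  have hm₂ : v₂ ∈ z := hz₂ ▸ Sym2.mem_mk_left _ _
  have hm₃ : v₃ ∈ z := hz₃ ▸ Sym2.mem_mk_left _ _
  induction z using Sym2.ind with
  | h x y =>
    rcases Sym2.mem_iff.1 hm₁ with h₁ | h₁ <;> rcases Sym2.mem_iff.1 hm₂ with h₂ | h₂ <;>
      rcases Sym2.mem_iff.1 hm₃ with h₃ | h₃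
    · exact Or.inl (H hz₁ hz₂ (h₁.trans h₂.symm))
    · exact Or.inl (H hz₁ hz₂ (h₁.trans h₂.symm))
    · exact Or.inr (Or.inl (H hz₁ hz₃ (h₁.trans h₃.symm)))
    · exact Or.inr (Or.inr (H hz₂ hz₃ (h₂.trans h₃.symm)))
    · exact Or.inr (Or.inr (H hz₂ hz₃ (h₂.trans h₃.symm)))
    · exact Or.inr (Or.inl (H hz₁ hz₃ (h₁.trans h₃.symm)))
    · exact Or.inl (H hz₁ hz₂ (h₁.trans h₂.symm))
    · exact Or.inl (H hz₁ hz₂ (h₁.trans h₂.symm))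

/-! ### An exploration path visits a medial vertex at most twice -/

/-- The `k`-th dart of a list is the pair of its `k`-th and `(k+1)`-st entries. -/
theorem getElem_zip_tail {α : Type*} (l : List α) (k : ℕ) (hk : k < (l.zip l.tail).length) :
    (l.zip l.tail)[k] = (l[k]'(by simp at hk; omega), l[k + 1]'(by simp at hk; omega)) := by
  simp [List.getElem_zip, List.getElem_tail]

/-- **At most two passages.** For every medial exploration path (of any datum and configuration)
and every medial vertex `z`, at most two positions of the path carry `z`. -/
theorem card_passages_le_two {D : DiscreteDobrushin} {ω : BondConfig (Site 2)}
    {γ : List MedialVertex} (hγ : IsMedialExploration D ω γ) (z : MedialVertex) :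
    ((Finset.range γ.length).filter (fun k => γ[k]? = some z)).card ≤ 2 := by
  classical
  set F := (Finset.range γ.length).filter (fun k => γ[k]? = some z) with hF
  have memF : ∀ {k}, k ∈ F ↔ ∃ hk : k < γ.length, γ[k] = z := by
    intro k
    rw [hF, Finset.mem_filter, Finset.mem_range]
    constructor
    · rintro ⟨hk, h⟩
      exact ⟨hk, by rwa [List.getElem?_eq_getElem hk, Option.some_inj] at h⟩
    · rintro ⟨hk, h⟩
      exact ⟨hk, by rw [List.getElem?_eq_getElem hk, h]⟩
  have hlenZ : (γ.zip γ.tail).length = γ.length - 1 := by simp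
  -- the dart entering position `k + 1` and the dart leaving position `k`
  have dartIn : ∀ k (hk : k + 1 < γ.length), γ[k + 1] = z → IsMedialDart γ[k] z := by
    intro k hk hz
    have := (hγ.step _ _ (infix_pair_getElem γ k hk)).isMedialDart
    rwa [hz] at this
  have dartOut : ∀ k (hk : k + 1 < γ.length), γ[k] = z → IsMedialDart z γ[k + 1] := by
    intro k hk hz
    have := (hγ.step _ _ (infix_pair_getElem γ k hk)).isMedialDart
    rwa [hz] at this
  -- no dart is repeated
  have inj : ∀ k₁ k₂ (hk₁ : k₁ + 1 < γ.length) (hk₂ : k₂ + 1 < γ.length),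
      γ[k₁] = γ[k₂] → γ[k₁ + 1] = γ[k₂ + 1] → k₁ = k₂ := by
    intro k₁ k₂ hk₁ hk₂ h h'
    have hz₁ : k₁ < (γ.zip γ.tail).length := by rw [hlenZ]; omega
    have hz₂ : k₂ < (γ.zip γ.tail).length := by rw [hlenZ]; omega
    have : (γ.zip γ.tail)[k₁] = (γ.zip γ.tail)[k₂] := by
      rw [getElem_zip_tail, getElem_zip_tail, h, h']
    exact (hγ.nodup.getElem_inj_iff).1 this
  -- at most two positions `≥ 1` (incoming darts)
  have hIn : (F.filter fun k => 1 ≤ k).card ≤ 2 := by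
    by_contra h
    obtain ⟨a, ha, b, hb, c, hc, hab, hac, hbc⟩ := Finset.two_lt_card.1 (not_le.1 h)
    rw [Finset.mem_filter] at ha hb hc
    obtain ⟨a, rfl⟩ : ∃ a', a = a' + 1 := ⟨a - 1, by omega⟩
    obtain ⟨b, rfl⟩ : ∃ b', b = b' + 1 := ⟨b - 1, by omega⟩
    obtain ⟨c, rfl⟩ : ∃ c', c = c' + 1 := ⟨c - 1, by omega⟩
    obtain ⟨hal, haz⟩ := memF.1 ha.1
    obtain ⟨hbl, hbz⟩ := memF.1 hb.1
    obtain ⟨hcl, hcz⟩ := memF.1 hc.1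
    rcases eq_or_eq_of_isMedialDart_target (dartIn a hal haz) (dartIn b hbl hbz)
        (dartIn c hcl hcz) with h | h | h
    · exact hab (by rw [inj a b hal hbl h (haz.trans hbz.symm)])
    · exact hac (by rw [inj a c hal hcl h (haz.trans hcz.symm)])
    · exact hbc (by rw [inj b c hbl hcl h (hbz.trans hcz.symm)])
  -- at most two positions `< length - 1` (outgoing darts)
  have hOut : (F.filter fun k => k + 1 < γ.length).card ≤ 2 := by
    by_contra h
    obtain ⟨a, ha, b, hb, c, hc, hab, hac, hbc⟩ := Finset.two_lt_card.1 (not_le.1 h)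
    rw [Finset.mem_filter] at ha hb hc
    obtain ⟨_, haz⟩ := memF.1 ha.1
    obtain ⟨_, hbz⟩ := memF.1 hb.1
    obtain ⟨_, hcz⟩ := memF.1 hc.1
    rcases eq_or_eq_of_isMedialDart_source (dartOut a ha.2 haz) (dartOut b hb.2 hbz)
        (dartOut c hc.2 hcz) with h | h | h
    · exact hab (inj a b ha.2 hb.2 (haz.trans hbz.symm) h)
    · exact hac (inj a c ha.2 hc.2 (haz.trans hcz.symm) h)
    · exact hbc (inj b c hb.2 hc.2 (hbz.trans hcz.symm) h)
  -- the first and the last position cannot both carry `z`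
  by_cases h0 : (0 : ℕ) ∈ F
  · by_cases hL : γ.length - 1 ∈ F
    · exfalso
      obtain ⟨h0l, h0z⟩ := memF.1 h0
      obtain ⟨hLl, hLz⟩ := memF.1 hL
      apply hγ.head_ne_getLast
      rw [List.head_eq_getElem, List.getLast_eq_getElem, h0z, hLz]
    · refine le_trans (Finset.card_le_card fun k hk => ?_) hOut
      rw [Finset.mem_filter]
      obtain ⟨hkl, -⟩ := memF.1 hk
      refine ⟨hk, ?_⟩
      by_contra hcon
      obtain rfl : k = γ.length - 1 := by omega
      exact hL hk
  · refine le_trans (Finset.card_le_card fun k hk => ?_) hIn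
    rw [Finset.mem_filter]
    refine ⟨hk, ?_⟩
    by_contra hcon
    obtain rfl : k = 0 := by omega
    exact h0 hk

/-- `medialExploration` visits every medial vertex at most twice (it is `[]` or an exploration). -/
theorem card_passages_medialExploration_le_two (E : DiscreteDobrushin) (ω : BondConfig (Site 2))
    (z : MedialVertex) :
    ((Finset.range (medialExploration E ω).length).filter
      (fun k => (medialExploration E ω)[k]? = some z)).card ≤ 2 := by
  rcases medialExploration_eq_nil_or E ω with h | h
  · rw [h]; simp
  · exact card_passages_le_two h z

/-! ### Norm bounds -/

/-- The passage sum is a sum of unit phases: its norm is at most the number of passages. -/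
theorem norm_passageSum_le_card (γ : List MedialVertex) (δ σ : ℝ) (z : MedialVertex) :
    ‖MedialPath.passageSum γ δ σ z‖ ≤
      ((Finset.range γ.length).filter (fun k => γ[k]? = some z)).card := by
  rw [MedialPath.passageSum_eq]
  refine (norm_sum_le _ _).trans (le_of_eq ?_)
  have : ∀ k ∈ (Finset.range γ.length).filter (fun k => γ[k]? = some z),
      ‖Complex.exp (-Complex.I * σ * (MedialPath.windingAt γ δ k : ℝ))‖ = 1 := by
    intro k _
    rw [show -Complex.I * σ * (MedialPath.windingAt γ δ k : ℝ) =
        ((-(σ * MedialPath.windingAt γ δ k) : ℝ) : ℂ) * Complex.I by push_cast; ring,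
      Complex.norm_exp_ofReal_mul_I]
  rw [Finset.sum_congr rfl this, Finset.sum_const, nsmul_eq_mul, mul_one]

/-- **Pathwise envelope**: the twisted passage sum of the medial exploration has norm `≤ 2`. -/
theorem norm_passageSum_medialExploration_le_two (E : DiscreteDobrushin) (ω : BondConfig (Site 2))
    (δ σ : ℝ) (z : MedialVertex) :
    ‖MedialPath.passageSum (medialExploration E ω) δ σ z‖ ≤ 2 :=
  (norm_passageSum_le_card _ _ _ _).trans
    (by exact_mod_cast card_passages_medialExploration_le_two E ω z)

/-- **Envelope of the conditional amplitude** (registered glue `norm_condObs_le`): for every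
datum, square, outer configuration and medial vertex, `‖condObs E Q ξ z‖ ≤ 2`. -/
theorem norm_condObs_le : ∀ (E : DiscreteDobrushin) (Q : Set (Site 2)) (ξ : BondConfig (Site 2)) (z : MedialVertex), ‖condObs E Q ξ z‖ ≤ 2 := by
  intro E Q ξ z
  have h := norm_integral_le_of_norm_le_const (μ := Pc) (C := 2)
    (f := fun ω => MedialPath.passageSum (medialExploration E (splice Q ξ ω)) E.δ (1 / 3) z)
    (Eventually.of_forall fun ω => norm_passageSum_medialExploration_le_two _ _ _ _ _)
  simpa [condObs] using h

/-- **Envelope of the observable** (registered glue `norm_obs_le`): `‖obs E z‖ ≤ 2`. -/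
theorem norm_obs_le : ∀ (E : DiscreteDobrushin) (z : MedialVertex), ‖obs E z‖ ≤ 2 := by
  intro E z
  have h := norm_integral_le_of_norm_le_const (μ := Pc) (C := 2)
    (f := fun ω => MedialPath.passageSum (medialExploration E ω) E.δ (1 / 3) z)
    (Eventually.of_forall fun ω => norm_passageSum_medialExploration_le_two _ _ _ _ _)
  simpa [obs] using h

end Summit.CriticalPhenomena.CardyFormulaZ2.Cruxes.ParafermionToSLESixFamilies.CaratheodoryNetSlitUniformity

end
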